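import Summits.NavierStokesRegularity.NavierStokesRegularity.Theses.OddMorawetz
import Summits.NavierStokesRegularity.NavierStokesRegularity.Theorems.OddMorawetzDefs
import Summits.NavierStokesRegularity.NavierStokesRegularity.Theorems.OddMorawetzLocal.Negative.OddMorawetzLocalSymmetryDefs

/-!
# Crux `OddMorawetzLocal` (stmt-NavierStokesRegularity-1376) — fields and jets under signed coordinate permutations

First half of the symmetry reduction (negative knowledge for the hunt, `Theorems/OddMorawetzLocal/Negative/`).
For a signed coordinate permutation `g = signedPerm σ ε ∈ B₃` and the rotated field `g_* v := rotateField g v`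
(`x ↦ g (v (g⁻¹ x))`, the tree's `rotateField`):
* `eulerBilinear_rotateField` — **`B(g_*v, g_*v) = g_* B(v,v)`** for differentiable `v`: the convective term is
  covariant by the chain rule, the vector Fourier transform intertwines `g_*` with the complex signed permutation
  (`fourierVec_rotateField`, from Mathlib's `Real.fourier_comp_linearIsometry` and the commutation of Bochner
  integrals with linear isometries), and the Leray symbol is covariant, `P̂(gξ)(g c) = g (P̂(ξ) c)`
  (`leraySymbolC_signedPerm`), so the function-level projector commutes with `g_*` (`lerayProjFun_rotateField`);
* `isSchwartzField_rotateField`, `isDivFree_rotateField` — the admissible class of the crux is `B₃`-stable;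
* `iteratedFDeriv_rotateField`, `jet_rotateField` — `J(g_*v)(x) = jetAct g (Jv (g⁻¹x))`;
* the group law `signedPerm_trans`, the actions `mlAct_mlAct` / `jetAct_jetAct`, and `b3_translate_bijective`.
Consumer: `OddMorawetzLocalB3Reduction.lean`. Everything is proved; no definitions, no named facts.

## References
* T. Tao, *Finite time blowup for an averaged three-dimensional Navier–Stokes equation*, JAMS 29 (2016), §1.1
  (rotation symmetry of the Euler bilinear operator, Def. 1.2 `Rot_R`).
-/

noncomputable section

open MeasureTheory FourierTransform
open Literature.Analysis Literature.Analysis.FluidPDE Literature.Analysis.FunctionSpaces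

set_option linter.dupNamespace false

namespace Summit.NavierStokesRegularity.NavierStokesRegularity.Theorems.OddMorawetz

/-! ### Part F — fields under signed coordinate permutations -/

section Fields

variable (σ : Equiv.Perm (Fin 3)) (ε : Fin 3 → ℤˣ)

/-- Complexification intertwines the real and complex signed permutations. -/
theorem complexify_signedPerm (x : E3) :
    EuclideanSpace.complexify (signedPerm σ ε x) = signedPermLI ℂ σ ε (EuclideanSpace.complexify x) := by
  ext i
  simp

/-- Real part intertwines the complex and real signed permutations. -/
theorem realPart_signedPermC (c : EuclideanSpace ℂ (Fin 3)) :
    FluidPDE.realPart (signedPermLI ℂ σ ε c) = signedPerm σ ε (FluidPDE.realPart c) := by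
  ext i
  simp [FluidPDE.realPart_apply]

/-- The bilinear pairing `∑ ξᵢ cᵢ` is invariant under a simultaneous signed permutation. -/
theorem sum_signedPerm_mul (ξ : E3) (c : EuclideanSpace ℂ (Fin 3)) :
    (∑ i, ((signedPerm σ ε ξ i : ℝ) : ℂ) * signedPermLI ℂ σ ε c i) = ∑ j, ((ξ j : ℝ) : ℂ) * c j := by
  have h : ∀ i, ((signedPerm σ ε ξ i : ℝ) : ℂ) * signedPermLI ℂ σ ε c i = ((ξ (σ.symm i) : ℝ) : ℂ) * c (σ.symm i) := by
    intro i
    simp only [signedPerm, signedPermLI_apply, Complex.ofReal_mul, Complex.ofReal_intCast]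
    have hε : ((ε i : ℤ) : ℂ) * ((ε i : ℤ) : ℂ) = 1 := by
      rcases Int.units_eq_one_or (ε i) with h | h <;> simp [h]
    linear_combination (((ξ (σ.symm i) : ℝ) : ℂ) * c (σ.symm i)) * hε
  simp_rw [h]
  exact Equiv.sum_comp σ.symm (fun j => ((ξ j : ℝ) : ℂ) * c j)

/-- **The Leray symbol is covariant under signed permutations**: `P̂(gξ)(g c) = g (P̂(ξ) c)`. -/
theorem leraySymbolC_signedPerm (ξ : E3) (c : EuclideanSpace ℂ (Fin 3)) :
    leraySymbolC (signedPerm σ ε ξ) (signedPermLI ℂ σ ε c) = signedPermLI ℂ σ ε (leraySymbolC ξ c) := by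
  simp only [leraySymbolC, sum_signedPerm_mul, LinearIsometryEquiv.norm_map, map_sub, map_smul,
    complexify_signedPerm]

/-- Fourier transform of `L ∘ f` for a complex linear isometry equivalence `L` (no integrability needed). -/
theorem fourier_comp_linearIsometryEquiv {V F G : Type*} [NormedAddCommGroup V] [InnerProductSpace ℝ V]
    [FiniteDimensional ℝ V] [MeasurableSpace V] [BorelSpace V]
    [NormedAddCommGroup F] [NormedSpace ℂ F] [CompleteSpace F] [NormedAddCommGroup G] [NormedSpace ℂ G]
    [CompleteSpace G] (L : F ≃ₗᵢ[ℂ] G) (f : V → F) (w : V) : 𝓕 (fun x => L (f x)) w = L (𝓕 f w) := by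
  simp only [Real.fourier_eq]
  have h := L.toLinearIsometry.integral_comp_comm (μ := volume) (fun v => 𝐞 (-inner ℝ v w) • f v)
  simp only [LinearIsometryEquiv.coe_toLinearIsometry, Circle.smul_def, map_smul] at h
  simp only [Circle.smul_def]
  exact h

/-- Inverse Fourier transform of `L ∘ f` for a complex linear isometry equivalence `L`. -/
theorem fourierInv_comp_linearIsometryEquiv {V F G : Type*} [NormedAddCommGroup V] [InnerProductSpace ℝ V]
    [FiniteDimensional ℝ V] [MeasurableSpace V] [BorelSpace V]
    [NormedAddCommGroup F] [NormedSpace ℂ F] [CompleteSpace F] [NormedAddCommGroup G] [NormedSpace ℂ G]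
    [CompleteSpace G] (L : F ≃ₗᵢ[ℂ] G) (f : V → F) (w : V) : 𝓕⁻ (fun x => L (f x)) w = L (𝓕⁻ f w) := by
  simp only [Real.fourierInv_eq]
  have h := L.toLinearIsometry.integral_comp_comm (μ := volume) (fun v => 𝐞 (inner ℝ v w) • f v)
  simp only [LinearIsometryEquiv.coe_toLinearIsometry, Circle.smul_def, map_smul] at h
  simp only [Circle.smul_def]
  exact h

/-- **The vector Fourier transform intertwines the rotation of fields**:
`(g_* w)^(ξ) = g_ℂ ŵ(g⁻¹ ξ)` for a signed permutation `g`. -/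
theorem fourierVec_rotateField (w : E3 → E3) (ξ : E3) :
    fourierVec (rotateField (signedPerm σ ε) w) ξ =
      signedPermLI ℂ σ ε (fourierVec w ((signedPerm σ ε).symm ξ)) := by
  unfold fourierVec
  have h1 : (EuclideanSpace.complexify ∘ rotateField (signedPerm σ ε) w) =
      fun x => signedPermLI ℂ σ ε (((EuclideanSpace.complexify ∘ w) ∘ (signedPerm σ ε).symm) x) := by
    funext x
    simp [rotateField, complexify_signedPerm]
  rw [h1, fourier_comp_linearIsometryEquiv, Real.fourier_comp_linearIsometry]

/-- **The function-level Leray projector commutes with signed permutations**: `P (g_* w) = g_* (P w)`. -/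
theorem lerayProjFun_rotateField (w : E3 → E3) :
    lerayProjFun (rotateField (signedPerm σ ε) w) = rotateField (signedPerm σ ε) (lerayProjFun w) := by
  funext x
  simp only [lerayProjFun, rotateField]
  have h1 : (fun ξ => leraySymbolC ξ (fourierVec (rotateField (signedPerm σ ε) w) ξ)) =
      fun ξ => signedPermLI ℂ σ ε (((fun η => leraySymbolC η (fourierVec w η)) ∘ (signedPerm σ ε).symm) ξ) := by
    funext ξ
    rw [fourierVec_rotateField, Function.comp_apply]
    conv_lhs => rw [show ξ = signedPerm σ ε ((signedPerm σ ε).symm ξ) from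
      ((signedPerm σ ε).apply_symm_apply ξ).symm]
    rw [leraySymbolC_signedPerm, LinearIsometryEquiv.apply_symm_apply]
  rw [h1, fourierInv_comp_linearIsometryEquiv, Real.fourierInv_comp_linearIsometry, realPart_signedPermC]

variable {σ ε}
variable {v : E3 → E3}

/-- Derivative of a rotated field: `D(g_* v)(x) = g ∘ Dv(g⁻¹x) ∘ g⁻¹` (any linear isometry `g`). -/
theorem fderiv_rotateField (hv : Differentiable ℝ v) (g : E3 ≃ₗᵢ[ℝ] E3) (x : E3) :
    fderiv ℝ (rotateField g v) x =
      ((g : E3 →L[ℝ] E3).comp (fderiv ℝ v (g.symm x))).comp ((g.symm : E3 ≃ₗᵢ[ℝ] E3) : E3 →L[ℝ] E3) := by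
  have h1 : HasFDerivAt (fun y => v (g.symm y)) ((fderiv ℝ v (g.symm x)).comp ((g.symm : E3 ≃ₗᵢ[ℝ] E3) : E3 →L[ℝ] E3)) x :=
    (hv (g.symm x)).hasFDerivAt.comp x (g.symm : E3 ≃ₗᵢ[ℝ] E3).toContinuousLinearEquiv.hasFDerivAt
  have h2 := ((g : E3 ≃ₗᵢ[ℝ] E3).toContinuousLinearEquiv.hasFDerivAt (x := v (g.symm x))).comp x h1
  exact h2.fderiv

/-- The symmetrised convective term is covariant: `(g_*v·∇)(g_*v) = g_* ((v·∇)v)`. -/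
theorem convect_rotateField (hv : Differentiable ℝ v) (g : E3 ≃ₗᵢ[ℝ] E3) :
    (fun x => convect (rotateField g v) (rotateField g v) x + convect (rotateField g v) (rotateField g v) x) =
      rotateField g (fun y => convect v v y + convect v v y) := by
  funext x
  simp only [convect_apply, fderiv_rotateField hv, rotateField, ContinuousLinearMap.comp_apply, map_add]
  simp

/-- **The Euler bilinear operator is covariant under signed permutations**: `B(g_*v, g_*v) = g_* B(v,v)`. -/
theorem eulerBilinear_rotateField (hv : Differentiable ℝ v) (σ : Equiv.Perm (Fin 3)) (ε : Fin 3 → ℤˣ) :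
    eulerBilinear (rotateField (signedPerm σ ε) v) (rotateField (signedPerm σ ε) v) =
      rotateField (signedPerm σ ε) (eulerBilinear v v) := by
  unfold eulerBilinear
  rw [convect_rotateField hv, lerayProjFun_rotateField]
  funext x
  simp [rotateField]

/-- Schwartz fields are stable under rotation by a linear isometry. -/
theorem isSchwartzField_rotateField (hv : IsSchwartzField v) (g : E3 ≃ₗᵢ[ℝ] E3) :
    IsSchwartzField (rotateField g v) := by
  obtain ⟨f, hf⟩ := hv
  refine ⟨SchwartzMap.postcompCLM (𝕜 := ℝ) (g : E3 →L[ℝ] E3)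
    (SchwartzMap.compCLMOfContinuousLinearEquiv ℝ (g.symm : E3 ≃ₗᵢ[ℝ] E3).toContinuousLinearEquiv f), ?_⟩
  funext x
  simp [hf, rotateField]

/-- Divergence-free fields are stable under rotation by a linear isometry (the trace is conjugation invariant). -/
theorem isDivFree_rotateField (hv : Differentiable ℝ v) (hd : VectorCalculus.IsDivFree v) (g : E3 ≃ₗᵢ[ℝ] E3) :
    VectorCalculus.IsDivFree (rotateField g v) := by
  intro x
  have hid : (((g.symm : E3 ≃ₗᵢ[ℝ] E3) : E3 →L[ℝ] E3) : E3 →ₗ[ℝ] E3) ∘ₗ ((g : E3 →L[ℝ] E3) : E3 →ₗ[ℝ] E3) =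
      LinearMap.id := LinearMap.ext fun y => by simp
  have h : VectorCalculus.divergence (rotateField g v) x = VectorCalculus.divergence v (g.symm x) := by
    unfold VectorCalculus.divergence
    rw [fderiv_rotateField hv g x]
    have hc : ((((g : E3 →L[ℝ] E3).comp (fderiv ℝ v (g.symm x))).comp ((g.symm : E3 ≃ₗᵢ[ℝ] E3) : E3 →L[ℝ] E3)
        : E3 →L[ℝ] E3) : E3 →ₗ[ℝ] E3) =
        ((g : E3 →L[ℝ] E3) : E3 →ₗ[ℝ] E3) ∘ₗ (((fderiv ℝ v (g.symm x) : E3 →L[ℝ] E3) : E3 →ₗ[ℝ] E3) ∘ₗ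
          (((g.symm : E3 ≃ₗᵢ[ℝ] E3) : E3 →L[ℝ] E3) : E3 →ₗ[ℝ] E3)) := rfl
    rw [hc, LinearMap.trace_comp_comm', LinearMap.comp_assoc, hid, LinearMap.comp_id]
  rw [h]
  exact hd (g.symm x)

end Fields

/-! ### Part J — jets under rotations, the group law -/

section Jets

variable {v : E3 → E3}

/-- `Dⁿ(g_* v)(x) = g ∘ Dⁿv(g⁻¹x) ∘ (g⁻¹, …, g⁻¹) = mlAct g n (Dⁿ v (g⁻¹ x))`. -/
theorem iteratedFDeriv_rotateField (hv : ContDiff ℝ (⊤ : ℕ∞) v) (g : E3 ≃ₗᵢ[ℝ] E3) (n : ℕ) (x : E3) :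
    iteratedFDeriv ℝ n (rotateField g v) x = mlAct g n (iteratedFDeriv ℝ n v (g.symm x)) := by
  have h1 : rotateField g v = (g : E3 ≃ₗᵢ[ℝ] E3).toContinuousLinearEquiv ∘
      (v ∘ ⇑((g.symm : E3 ≃ₗᵢ[ℝ] E3) : E3 →L[ℝ] E3)) := by
    funext y
    simp [rotateField]
  have hvn : ContDiff ℝ ((n : ℕ) : WithTop ℕ∞) v := hv.of_le (ENat.natCast_le_of_coe_top_le_withTop le_rfl n)
  rw [h1, ContinuousLinearEquiv.iteratedFDeriv_comp_left,
    ContinuousLinearMap.iteratedFDeriv_comp_right _ hvn x le_rfl]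
  refine ContinuousMultilinearMap.ext fun u => ?_
  simp [mlAct_apply]

/-- The 3-jet of a rotated field: `J(g_* v)(x) = jetAct g (Jv(g⁻¹ x))`. -/
theorem jet_rotateField (hv : ContDiff ℝ (⊤ : ℕ∞) v) (g : E3 ≃ₗᵢ[ℝ] E3) (x : E3) :
    ((rotateField g v x, iteratedFDeriv ℝ 1 (rotateField g v) x, iteratedFDeriv ℝ 2 (rotateField g v) x,
        iteratedFDeriv ℝ 3 (rotateField g v) x) : Jet3) =
      jetAct g ((v (g.symm x), iteratedFDeriv ℝ 1 v (g.symm x), iteratedFDeriv ℝ 2 v (g.symm x),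
        iteratedFDeriv ℝ 3 v (g.symm x)) : Jet3) := by
  rw [jetAct_apply, iteratedFDeriv_rotateField hv g 1, iteratedFDeriv_rotateField hv g 2,
    iteratedFDeriv_rotateField hv g 3]
  rfl

/-- Chain rule through the (linear) jet action. -/
theorem fderiv_comp_jetAct {m : Jet3 → ℝ} (hm : Differentiable ℝ m) (g : E3 ≃ₗᵢ[ℝ] E3) (z w : Jet3) :
    fderiv ℝ (m ∘ ⇑(jetAct g)) z w = fderiv ℝ m (jetAct g z) (jetAct g w) := by
  rw [((hm _).hasFDerivAt.comp z (jetAct g).hasFDerivAt).fderiv]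
  rfl

/-- The identity is a signed permutation. -/
theorem signedPerm_one : signedPerm 1 1 = LinearIsometryEquiv.refl ℝ E3 := by
  ext x i
  simp [signedPerm, show (1 : Equiv.Perm (Fin 3)).symm = 1 from rfl]

/-- Rotating by the identity does nothing. -/
theorem rotateField_refl (v : E3 → E3) : rotateField (LinearIsometryEquiv.refl ℝ E3) v = v := by
  funext x
  rfl

/-- Group law of the signed permutations: `g_{σ,ε} ∘ g_{σ₀,ε₀} = g_{σ∘σ₀, ε·(ε₀∘σ⁻¹)}`. -/
theorem signedPerm_trans (σ₀ σ : Equiv.Perm (Fin 3)) (ε₀ ε : Fin 3 → ℤˣ) :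
    (signedPerm σ₀ ε₀).trans (signedPerm σ ε) = signedPerm (σ₀.trans σ) (fun i => ε i * ε₀ (σ.symm i)) := by
  ext x i
  simp only [signedPerm, LinearIsometryEquiv.trans_apply, signedPermLI_apply, Equiv.symm_trans_apply,
    Units.val_mul, Int.cast_mul]
  ring

/-- `mlAct` is an action: `mlAct g (mlAct h A) = mlAct (h ≫ g) A`. -/
theorem mlAct_mlAct (g h : E3 ≃ₗᵢ[ℝ] E3) (n : ℕ) (A : E3 [×n]→L[ℝ] E3) :
    mlAct g n (mlAct h n A) = mlAct (h.trans g) n A := by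
  refine ContinuousMultilinearMap.ext fun u => ?_
  simp [mlAct_apply, LinearIsometryEquiv.trans_apply]

/-- `jetAct` is an action. -/
theorem jetAct_jetAct (g h : E3 ≃ₗᵢ[ℝ] E3) (z : Jet3) : jetAct g (jetAct h z) = jetAct (h.trans g) z := by
  simp only [jetAct_apply, mlAct_mlAct, LinearIsometryEquiv.trans_apply]

/-- Right translation by a fixed signed permutation is a bijection of `B₃` (in the `(σ, ε)` parametrisation). -/
theorem b3_translate_bijective (σ₀ : Equiv.Perm (Fin 3)) (ε₀ : Fin 3 → ℤˣ) :
    Function.Bijective (fun p : Equiv.Perm (Fin 3) × (Fin 3 → ℤˣ) =>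
      ((σ₀.trans p.1, fun i => p.2 i * ε₀ (p.1.symm i)) : Equiv.Perm (Fin 3) × (Fin 3 → ℤˣ))) := by
  refine (Finite.injective_iff_bijective).1 ?_
  rintro ⟨σ, ε⟩ ⟨σ', ε'⟩ h
  simp only [Prod.mk.injEq] at h
  obtain ⟨h1, h2⟩ := h
  have hσ : σ = σ' := by
    refine Equiv.ext fun j => ?_
    have := congrArg (fun τ : Equiv.Perm (Fin 3) => τ (σ₀.symm j)) h1
    simpa using this
  subst hσ
  refine Prod.ext rfl (funext fun i => ?_)
  have := congrArg (fun f : Fin 3 → ℤˣ => f i * ε₀ (σ.symm i)) h2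
  simpa [mul_assoc, Int.units_mul_self] using this

end Jets

end Summit.NavierStokesRegularity.NavierStokesRegularity.Theorems.OddMorawetz
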